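import Summits.CriticalPhenomena.SAWScalingLimit.Theses.SAWRenewalTightness
import Literature.Probability.RandomPlanarGeometry.SAWBridgeRadius
import Literature.Probability.RandomPlanarGeometry.SAWPatternTheorem

/-!
# Disproof attempts on `TubeLowerBound` (crux `stmt-CriticalPhenomena-4730`, route `SAWRenewalTightness` r4)

Standing adversary's work file (refuter-cdisprove; cycle 1 = gen 1, cycle 2 = gen 2, 2026-08-16).  Prose lives
in docstrings only.  CYCLE 2 (targets = the five stubs of the registered line `subcritical-renewal-floor`,
plus exact bridge-by-span numerics) is the section `## Cycle 2` at the end of this file; its index entries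
are marked (c2) below.
LANDED (importable, sorry-free) copies of everything below:
`Summits.CriticalPhenomena.SAWScalingLimit.Theorems.TubeLowerBound.Negative.TubeLowerBoundLoadBearing`
(p73398: `tubeMass`, `constraints`, `exponent_eq_zero_of_withoutOneLe`, `not_withoutSlack`,
`not_allN`, `twoPoint_floor`) and `….Negative.TubeLowerBoundFixedWidth` (p73728: `tubeMass_le_geom`,
`band_of_tube`, `not_occV_of_band`, `not_withoutDist`, `not_atFugacity_of_lt`), namespace
`Summit.CriticalPhenomena.SAWScalingLimit.Theorems.TubeLowerBound.Negative` (variants inlined there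
as `¬ (∃ C c, …)`; here they keep their `def` names); and (cycle 2) `….Negative.SubcriticalRenewalFloorTargets`
(p76010, commit f25b31447bf3: `tightTubeFloor_iff`, `coneMass_eq_zero`, `coneBridgeFloor_kappa_le`,
`coneBridgeFloor_witness_kappa_le`, statements inlined).

The crux (verbatim, see `tubeLowerBound_iff`): there are `C` and `c > 0` such that for all
`u v : ℤ²` and real `ℓ ≥ 1` with `|u - v| ≤ ℓ`, SOME partial sum (in the length `n`) of the
`x_c`-mass of self-avoiding walks `u → v` all of whose vertices stay within `ℓ/10 + 2` of the
segment `[u, v]` is `≥ c ℓ^{-C}`.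

## Findings (index)

* `tubeLowerBound_iff` — the crux restated through `tubeMass` (by `Iff.rfl`).
* (a) LOAD-BEARING HYPOTHESES
  - `constraints` — any witness `(C, c)` of the crux has `0 ≤ C` and `c ≤ 1` (instance `u = v`:
    the tube mass is identically `1`).  So the exponent can never be negative.
  - `exponent_eq_zero_of_withoutOneLe` — drop `1 ≤ ℓ` (keep `0 < ℓ`): the instance `u = v`,
    `ℓ → 0⁺` forces `C = 0`, i.e. the statement collapses to a UNIFORM floor
    `tubeMass ≥ c`, conjecturally false (critical two-point decay `|v|^{-η}`, `η = 5/24`) but not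
    refutable with today's theorems (no proved decay of `G_{x_c}` on `ℤ²`).
  - `not_withoutSlack` — drop the additive `+ 2` in the tube radius: FALSE (diagonal neighbours
    `u = 0`, `v = (1,1)`, `ℓ = 3/2`: the `ℓ/10`-tube contains no lattice path at all).
  - `not_withoutDist` — drop the aspect-ratio coupling `|u - v| ≤ ℓ`: FALSE.  Witness `ℓ = 1`,
    `u = 0`, `v = (L, L)`: the tube lies in the diagonal band `|x - y| ≤ 2`, where Kesten's
    pattern `V = N³ESENES³` (which needs six consecutive values of `x - y`) never occurs, so by
    the in-tree pattern theorem `SAW.Zd.thm723` the confined counts are `≤ ((1-ε)μ)^n` and the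
    critical mass decays exponentially in `L`.  ("Any proof must use that the tube WIDENS with ℓ.")
  - `not_allN` — replace `∃ N` by `∀ N`: FALSE trivially (`N = 0`, `u ≠ v`); the liminf form is
    essential and correct for a series of nonnegative terms.
  - `not_atFugacity_of_lt` / `atFugacity_subcritical_false` — replace `x_c` by any `x ∈ [0, x_c)`: FALSE (exponential decay of the
    subcritical two-point function from `c_n^{1/n} → μ`); criticality is load-bearing.  The
    supercritical side `x > x_c` only makes the floor easier (barrier
    `SupercriticalSAWSpaceFilling` is irrelevant to a LOWER bound).
* (b) WHAT THE CRUX ENTAILS — `twoPoint_floor`: the crux implies a pointwise polynomial lower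
  bound on (partial sums of) the critical two-point function, `G_{x_c}(0,v) ≥ c|v|^{-C}`, which
  Madras–Slade 1993 p. 259 record as unknown ("not aware of any rigorous lower bound of the form
  q_N ≥ const N^{-p} μ^N").  So the crux is at least as hard as that open problem; it is an
  RSW-type LOWER bound at criticality.
* (c) NATURAL STRENGTHENINGS — `C = 0` (uniform floor): conjecturally false, unprovable either way
  now (see `exponent_eq_zero_of_withoutOneLe`); `+2 ↦ +1`: still plausible (a monotone lattice
  staircase stays within distance `< 1` of any segment), not attackable; fixed tube width:
  refuted by `not_withoutDist` (width `21/10`, diagonal direction).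
* (c2) TARGETS — line `subcritical-renewal-floor` (skeleton aa7e283b6144): `tightTubeFloor_iff` (S5's
  target `TightTubeFloor` ↔ the crux), `coneBridgeFloor_kappa_le` / `coneMass_eq_zero` (any witness of the
  transfer statement `ConeBridgeFloor` has aperture `κ ≤ 1/4`: the end cone pins the start, `4|t| ≤ s`);
  S1 = print (MS (4.2.15)), S2/S3 open hyperscaling — cheapest falsifier RUN (exact strip transfer matrix,
  bridges by span and transversal displacement, Kesten tilt below `x_c`): consistent, no kill; see the
  NUMERICS paragraph of `## Cycle 2`.
* WHY IT RESISTS — heuristically TRUE with room to spare: by scale invariance confinement to a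
  tube of fixed aspect ratio costs `O(1)`, and `G_{x_c}(0,v) ≍ |v|^{-5/24}`, so any `C > 5/24`
  should do; a refutation needs super-polynomial decay of a critical confined two-point function,
  contradicting the SLE₈⸝₃ picture and the numerics in print (Guttmann–Kennedy, SAW in a
  rectangle; DGKLP arXiv:1008.4321, SAW spanning a strip).  No finite computation can refute an
  `∃ C` asymptotic floor.  Small scales are harmless: for `ℓ ≤ ℓ₀` finitely many classes, each
  with mass `≥ x_c^{‖v-u‖₁} > 0` (staircase inside the tube thanks to `+2`).
* NUMERICS (this seat; exact frontier transfer matrix over the tube graph, validated against brute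
  force; script `tm/tube_tm.py`, kit job j008447 extends to `ℓ ≤ 59`).  Axis pairs `u = 0`,
  `v = (ℓ, 0)`, full mass `Z(ℓ) = lim_N tubeMass x_c 0 (ℓ,0) (ℓ/10+2) N` at `x_c = 0.3790523`:
  `Z(1..9) = .548 .347 .264 .188 .135 .0971 .0700 .0505 .0375` (5 lattice rows),
  `Z(10..19) = .0507 .0397 .0333 .0261 .0204 .0160 .0125 .0102 .00800 .00626` (7 rows),
  `Z(20..29) = .01123 .00923 .00791 .00660 .00543 .00460 .00378 .00311 .00256 .00210` (9 rows;
  `Z` jumps UP at `ℓ = 10, 20` where the tube gains two rows).  Inside each constant-width regime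
  the decay is a clean exponential, ratio `0.7219` (5 rows) / `0.7832` (7) / `0.8223` (9) /
  `0.8495` (11, `Z(30..33) = .00414 .00362 .00308 .00262`), i.e. strip masses `m₅ = 0.326`,
  `m₇ = 0.244`, `m₉ = 0.196`, `m₁₁ = 0.163`, and `m_W (W+1) = 1.956, 1.955, 1.956, 1.957 ↑
  π·5/8 = 1.9635`: the CFT boundary exponent `5/8` of the SAW in a strip with free walls
  (`ξ_W = (W+1)/1.96`, LINEAR in the width — the RSW-type fact behind `not_withoutDist`'s moral).
  So the observed decay IS the finite-width strip mass; for the pair `(0, (ℓ,0))` the whole tube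
  has `W ≈ ℓ/5 + 5` rows, `m_W ℓ ≈ 9.8 ℓ/(ℓ + 25) → 9.8`, and the factor `exp(-m_W ℓ)` SATURATES
  at `e^{-9.8} ≈ 5·10⁻⁵` (decade envelope `Z(10), Z(20), Z(30) = .0507, .0112, .00414`, the last as
  predicted from `m_W`; predicted `Z(50) ≈ 1.3·10⁻³`, kit j008447 runs `ℓ ≤ 59`), leaving a polynomial — consistent with the crux (tiny `c` or
  moderate `C`), inconsistent with any kill.
-/

noncomputable section

namespace Summit.CriticalPhenomena.SAWScalingLimit.Cruxes.TubeLowerBound.Disproof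

open Literature.Probability.LatticeModels Literature.Probability.RandomPlanarGeometry
open Literature.Probability.RandomPlanarGeometry.SAW
open Summit.CriticalPhenomena.SAWScalingLimit.Theses.SAWRenewalTightness (TubeLowerBound)
open Filter Topology
open scoped BigOperators

/-! ### The tube mass -/

open Classical in
/-- `tubeMass x u v r N = Σ_{n ≤ N} Σ_{ω : n-step SAW u → v, all vertices within r of [u,v]} x^n`:
the partial sum up to length `N` of the `x`-mass of self-avoiding walks from `u` to `v` confined
to the closed `r`-neighbourhood of the segment `[u, v]` (the double sum of the crux, with the
fugacity and the tube radius made parameters). [folklore] -/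
def tubeMass (x : ℝ) (u v : Site 2) (r : ℝ) (N : ℕ) : ℝ :=
  ∑ n ∈ Finset.range (N + 1), ∑ _ω ∈ (Zd.sawFun 2 n (v - u)).filter
    (fun ω => ∀ i ≤ n, Metric.infDist (Site.toComplex (u + ω i))
      (segment ℝ (Site.toComplex u) (Site.toComplex v)) ≤ r), x ^ n

/-- The crux, restated through `tubeMass` (definitionally). [folklore] -/
theorem tubeLowerBound_iff :
    TubeLowerBound ↔ ∃ C c : ℝ, 0 < c ∧ ∀ (u v : Site 2) (ℓ : ℝ), 1 ≤ ℓ →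
      dist (Site.toComplex u) (Site.toComplex v) ≤ ℓ →
        ∃ N : ℕ, c * ℓ ^ (-C) ≤ tubeMass criticalFugacity u v (ℓ / 10 + 2) N :=
  Iff.rfl

/-! ### Elementary facts: walks from a point to itself -/

/-- No self-avoiding walk of positive length returns to its starting point. [folklore] -/
theorem sawFun_self_eq_empty {n : ℕ} (hn : n ≠ 0) : Zd.sawFun 2 n (0 : Site 2) = ∅ := by
  ext ω
  simp only [Finset.notMem_empty, iff_false]
  intro h
  obtain ⟨h0, hend, -, hinj⟩ := Zd.mem_sawFun.1 h
  have := hinj (show (0 : ℕ) ∈ {i | i ≤ n} from Nat.zero_le n)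
    (show n ∈ {i | i ≤ n} from le_refl n) (by rw [h0, hend n le_rfl])
  exact hn this.symm

/-- The only `0`-step walk from `0` to `0` is the constant one. [folklore] -/
theorem sawFun_zero_zero : Zd.sawFun 2 0 (0 : Site 2) = {fun _ => 0} := by
  ext ω
  rw [Zd.mem_sawFun, Finset.mem_singleton]
  constructor
  · rintro ⟨-, hend, -, -⟩
    funext i
    exact hend i (Nat.zero_le i)
  · rintro rfl
    refine ⟨rfl, fun i _ => rfl, fun i hi => absurd hi (Nat.not_lt_zero i), ?_⟩
    intro i hi j hj _
    simp only [Set.mem_setOf_eq, Nat.le_zero] at hi hj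
    rw [hi, hj]

/-- There is no `0`-step walk from `0` to `v ≠ 0`. [folklore] -/
theorem sawFun_zero_eq_empty {v : Site 2} (hv : v ≠ 0) : Zd.sawFun 2 0 v = ∅ := by
  ext ω
  simp only [Finset.notMem_empty, iff_false]
  intro h
  obtain ⟨h0, hend, -, -⟩ := Zd.mem_sawFun.1 h
  exact hv ((hend 0 le_rfl).symm.trans h0)

/-- An `n`-step walk from `0` to `v` has `n ≥ |v j|` for each coordinate `j`. [folklore] -/
theorem le_of_mem_sawFun {n : ℕ} {v : Site 2} {ω : ℕ → Site 2} (h : ω ∈ Zd.sawFun 2 n v)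
    (j : Fin 2) : |v j| ≤ n := by
  obtain ⟨h0, hend, hadj, -⟩ := Zd.mem_sawFun.1 h
  have := Zd.abs_apply_le_of_adj h0 hadj n le_rfl j
  rwa [hend n le_rfl] at this

/-- **`u = v`: the tube mass is identically `1`** (only the trivial walk; every partial sum).
[folklore] -/
theorem tubeMass_self (x : ℝ) (u : Site 2) {r : ℝ} (hr : 0 ≤ r) (N : ℕ) :
    tubeMass x u u r N = 1 := by
  classical
  unfold tubeMass
  rw [Finset.sum_eq_single_of_mem 0 (Finset.mem_range.2 (Nat.succ_pos N))]
  · rw [sub_self, sawFun_zero_zero, Finset.filter_singleton, if_pos, Finset.sum_singleton, pow_zero]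
    intro i _
    rw [add_zero]
    rw [Metric.infDist_zero_of_mem (left_mem_segment ℝ _ _)]
    exact hr
  · intro n _ hn
    rw [sub_self, sawFun_self_eq_empty hn, Finset.filter_empty, Finset.sum_empty]

/-- The tube mass is nonnegative for a nonnegative fugacity. [folklore] -/
theorem tubeMass_nonneg {x : ℝ} (hx : 0 ≤ x) (u v : Site 2) (r : ℝ) (N : ℕ) :
    0 ≤ tubeMass x u v r N :=
  Finset.sum_nonneg fun n _ => Finset.sum_nonneg fun _ _ => pow_nonneg hx n

/-! ### (a) Load-bearing analysis -/

/-- **Normalisation constraints.** Any witness `(C, c)` of the crux has `0 ≤ C` and `c ≤ 1`: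
at `u = v` the tube mass is `1` for every `ℓ ≥ 1`, so `c ℓ^{-C} ≤ 1` on `[1, ∞)`.  In particular
the exponent `-C` can never be positive ("the bound cannot grow with `ℓ`"). [folklore] -/
theorem constraints {C c : ℝ} (hc : 0 < c)
    (h : ∀ (u v : Site 2) (ℓ : ℝ), 1 ≤ ℓ → dist (Site.toComplex u) (Site.toComplex v) ≤ ℓ →
      ∃ N : ℕ, c * ℓ ^ (-C) ≤ tubeMass criticalFugacity u v (ℓ / 10 + 2) N) :
    0 ≤ C ∧ c ≤ 1 := by
  have key : ∀ ℓ : ℝ, 1 ≤ ℓ → c * ℓ ^ (-C) ≤ 1 := by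
    intro ℓ hℓ
    obtain ⟨N, hN⟩ := h 0 0 ℓ hℓ (by rw [dist_self]; linarith)
    rwa [tubeMass_self _ _ (by linarith) N] at hN
  constructor
  · by_contra hC
    push Not at hC
    have ht : Tendsto (fun ℓ : ℝ => c * ℓ ^ (-C)) atTop atTop :=
      Tendsto.const_mul_atTop hc (tendsto_rpow_atTop (by linarith))
    obtain ⟨ℓ, hℓ1, hℓ2⟩ := ((ht.eventually_gt_atTop 1).and (eventually_ge_atTop 1)).exists
    exact absurd (key ℓ hℓ2) (not_le.2 hℓ1)
  · simpa using key 1 le_rfl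

/-- The crux with the normalisation `1 ≤ ℓ` weakened to `0 < ℓ`. [folklore] -/
def WithoutOneLe : Prop :=
  ∃ C c : ℝ, 0 < c ∧ ∀ (u v : Site 2) (ℓ : ℝ), 0 < ℓ →
    dist (Site.toComplex u) (Site.toComplex v) ≤ ℓ →
      ∃ N : ℕ, c * ℓ ^ (-C) ≤ tubeMass criticalFugacity u v (ℓ / 10 + 2) N

/-- **Dropping `1 ≤ ℓ` forces `C = 0`.** With only `0 < ℓ`, the instance `u = v`, `ℓ = (c/2)^{1/C}`
kills every `C > 0` (and `constraints` kills `C < 0`), so the weakened statement is equivalent to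
the UNIFORM floor `tubeMass ≥ c` — conjecturally false (`G_{x_c}(0,v) → 0` like `|v|^{-5/24}`),
but no decay of the critical two-point function on `ℤ²` is proved, so this is as far as the
refutation goes: the hypothesis `1 ≤ ℓ` is what makes a positive exponent admissible. [folklore] -/
theorem exponent_eq_zero_of_withoutOneLe {C c : ℝ} (hc : 0 < c)
    (h : ∀ (u v : Site 2) (ℓ : ℝ), 0 < ℓ → dist (Site.toComplex u) (Site.toComplex v) ≤ ℓ →
      ∃ N : ℕ, c * ℓ ^ (-C) ≤ tubeMass criticalFugacity u v (ℓ / 10 + 2) N) :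
    C = 0 := by
  have hC0 : 0 ≤ C := (constraints hc fun u v ℓ hℓ hd => h u v ℓ (by linarith) hd).1
  have key : ∀ ℓ : ℝ, 0 < ℓ → c * ℓ ^ (-C) ≤ 1 := by
    intro ℓ hℓ
    obtain ⟨N, hN⟩ := h 0 0 ℓ hℓ (by rw [dist_self]; linarith)
    rwa [tubeMass_self _ _ (by linarith) N] at hN
  by_contra hC
  have hCpos : 0 < C := lt_of_le_of_ne hC0 (Ne.symm hC)
  have hb : 0 < c / 2 := by linarith
  have := key ((c / 2) ^ (1 / C)) (Real.rpow_pos_of_pos hb _)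
  rw [← Real.rpow_mul hb.le, show 1 / C * -C = -1 by field_simp, Real.rpow_neg_one] at this
  rw [show c * (c / 2)⁻¹ = 2 by field_simp] at this
  linarith

/-- `WithoutOneLe` collapses to the uniform floor (the `C = 0` strengthening of the crux). [folklore] -/
theorem withoutOneLe_iff_uniform :
    WithoutOneLe ↔ ∃ c : ℝ, 0 < c ∧ ∀ (u v : Site 2) (ℓ : ℝ), 0 < ℓ →
      dist (Site.toComplex u) (Site.toComplex v) ≤ ℓ →
        ∃ N : ℕ, c ≤ tubeMass criticalFugacity u v (ℓ / 10 + 2) N := by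
  constructor
  · rintro ⟨C, c, hc, h⟩
    have hC := exponent_eq_zero_of_withoutOneLe hc h
    subst hC
    refine ⟨c, hc, fun u v ℓ hℓ hd => ?_⟩
    obtain ⟨N, hN⟩ := h u v ℓ hℓ hd
    exact ⟨N, by simpa using hN⟩
  · rintro ⟨c, hc, h⟩
    refine ⟨0, c, hc, fun u v ℓ hℓ hd => ?_⟩
    obtain ⟨N, hN⟩ := h u v ℓ hℓ hd
    exact ⟨N, by simpa using hN⟩

/-- The crux with the additive slack `+ 2` removed from the tube radius. [folklore] -/
def WithoutSlack : Prop :=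
  ∃ C c : ℝ, 0 < c ∧ ∀ (u v : Site 2) (ℓ : ℝ), 1 ≤ ℓ →
    dist (Site.toComplex u) (Site.toComplex v) ≤ ℓ →
      ∃ N : ℕ, c * ℓ ^ (-C) ≤ tubeMass criticalFugacity u v (ℓ / 10) N

/-- **The additive slack is load-bearing**: without `+ 2`, the diagonal neighbours `u = 0`,
`v = (1, 1)` at `ℓ = 3/2` have an EMPTY tube (every first step leaves the `3/20`-neighbourhood of
the diagonal segment: a lattice neighbour `p` of `0` has `|p₁ - p₂| = 1`, hence distance
`≥ 1/√2` from the diagonal), so the mass is `0 < c (3/2)^{-C}`. [folklore] -/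
theorem not_withoutSlack : ¬ WithoutSlack := by
  classical
  rintro ⟨C, c, hc, h⟩
  have toComplex_zero : Site.toComplex (0 : Site 2) = 0 := by
    apply Complex.ext <;> simp [Site.toComplex]
  have hv : Site.toComplex (![1, 1] : Site 2) = ⟨1, 1⟩ := by
    apply Complex.ext <;> simp [Site.toComplex]
  have hdist : dist (Site.toComplex (0 : Site 2)) (Site.toComplex (![1, 1] : Site 2)) ≤ 3 / 2 := by
    rw [toComplex_zero, hv, Complex.dist_eq, zero_sub, norm_neg]
    have h2 : ‖(⟨1, 1⟩ : ℂ)‖ ^ 2 = 2 := by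
      rw [Complex.sq_norm, Complex.normSq_apply]; norm_num
    nlinarith [norm_nonneg (⟨1, 1⟩ : ℂ)]
  obtain ⟨N, hN⟩ := h 0 ![1, 1] (3 / 2) (by norm_num) hdist
  have hzero : tubeMass criticalFugacity 0 ![1, 1] (3 / 2 / 10) N = 0 := by
    unfold tubeMass
    refine Finset.sum_eq_zero fun n _ => Finset.sum_eq_zero fun ω hω => ?_
    exfalso
    rw [Finset.mem_filter, sub_zero] at hω
    obtain ⟨hω, htube⟩ := hω
    obtain ⟨h0, hend, hadj, -⟩ := Zd.mem_sawFun.1 hω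
    rcases Nat.eq_zero_or_pos n with rfl | hn1
    · have := congrFun ((hend 0 le_rfl).symm.trans h0) 0
      simp at this
    · have had := hadj 0 hn1
      rw [h0] at had
      have ht := htube 1 hn1
      rw [zero_add] at ht
      have hne : (segment ℝ (Site.toComplex (0 : Site 2)) (Site.toComplex (![1, 1] : Site 2))).Nonempty :=
        ⟨_, left_mem_segment ℝ _ _⟩
      obtain ⟨y, hy, hdy⟩ := (Metric.infDist_lt_iff hne).1
        (lt_of_le_of_lt ht (by norm_num : (3 : ℝ) / 2 / 10 < 1 / 2))
      rw [toComplex_zero, hv] at hy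
      obtain ⟨a, b, -, -, -, rfl⟩ := hy
      have hdiff : ((Site.toComplex (ω 1)).re - (Site.toComplex (ω 1)).im) ^ 2 = 1 := by
        obtain ⟨i, hi | hi⟩ := (Zd.zdGraph_adj_iff_sub _ _).1 had
        · rw [sub_zero] at hi
          rw [hi]
          fin_cases i <;> simp [Site.toComplex]
        · rw [zero_sub, neg_eq_iff_eq_neg] at hi
          rw [hi]
          fin_cases i <;> simp [Site.toComplex]
      have hns : (1 : ℝ) / 2 ≤ Complex.normSq (Site.toComplex (ω 1) - (a • (0 : ℂ) + b • (⟨1, 1⟩ : ℂ))) := by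
        rw [Complex.normSq_apply]
        simp only [Complex.sub_re, Complex.sub_im, smul_zero,
          zero_add, Complex.smul_re, Complex.smul_im, smul_eq_mul, mul_one]
        nlinarith [hdiff, sq_nonneg ((Site.toComplex (ω 1)).re - b + ((Site.toComplex (ω 1)).im - b))]
      have hsq : dist (Site.toComplex (ω 1)) (a • (0 : ℂ) + b • ⟨1, 1⟩) ^ 2 < 1 / 4 := by
        nlinarith [dist_nonneg (x := Site.toComplex (ω 1)) (y := a • (0 : ℂ) + b • ⟨1, 1⟩)]
      rw [Complex.dist_eq, Complex.sq_norm] at hsq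
      linarith
  rw [hzero] at hN
  have : 0 < c * (3 / 2 : ℝ) ^ (-C) := mul_pos hc (Real.rpow_pos_of_pos (by norm_num) _)
  linarith

/-- The crux with `∃ N` (some partial sum) strengthened to `∀ N` (every partial sum). [folklore] -/
def AllN : Prop :=
  ∃ C c : ℝ, 0 < c ∧ ∀ (u v : Site 2) (ℓ : ℝ), 1 ≤ ℓ →
    dist (Site.toComplex u) (Site.toComplex v) ≤ ℓ →
      ∀ N : ℕ, c * ℓ ^ (-C) ≤ tubeMass criticalFugacity u v (ℓ / 10 + 2) N

/-- **The liminf form `∃ N` is essential**: with `∀ N` the partial sum `N = 0` vanishes for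
`u ≠ v` (no `0`-step walk), e.g. `u = 0`, `v = (1, 0)`, `ℓ = 1`.  (Typing remark only: for a
series of nonnegative terms `∃ N` is the right monotone-robust floor.) [folklore] -/
theorem not_allN : ¬ AllN := by
  classical
  rintro ⟨C, c, hc, h⟩
  have toComplex_zero : Site.toComplex (0 : Site 2) = 0 := by
    apply Complex.ext <;> simp [Site.toComplex]
  have hv : Site.toComplex (![1, 0] : Site 2) = 1 := by
    apply Complex.ext <;> simp [Site.toComplex]
  have hv0 : (![1, 0] : Site 2) ≠ 0 := fun h => by simpa using congrFun h 0
  have := h 0 ![1, 0] 1 le_rfl (by rw [toComplex_zero, hv]; simp) 0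
  have hzero : tubeMass criticalFugacity 0 ![1, 0] (1 / 10 + 2) 0 = 0 := by
    unfold tubeMass
    rw [Finset.sum_range_one, sub_zero, sawFun_zero_eq_empty hv0, Finset.filter_empty,
      Finset.sum_empty]
  rw [hzero, Real.one_rpow, mul_one] at this
  linarith

/-! ### (b) What the crux entails: a pointwise polynomial floor for the critical two-point function -/

/-- A nonzero lattice point is at distance `≥ 1` from the origin. [folklore] -/
theorem one_le_dist_of_ne_zero {v : Site 2} (hv : v ≠ 0) :
    1 ≤ dist (Site.toComplex (0 : Site 2)) (Site.toComplex v) := by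
  have toComplex_zero : Site.toComplex (0 : Site 2) = 0 := by
    apply Complex.ext <;> simp [Site.toComplex]
  rw [toComplex_zero, Complex.dist_eq, zero_sub, norm_neg]
  have : v 0 ≠ 0 ∨ v 1 ≠ 0 := by
    by_contra hcon
    push Not at hcon
    apply hv
    funext j
    fin_cases j
    · exact hcon.1
    · exact hcon.2
  rcases this with h0 | h1
  · calc (1 : ℝ) ≤ |((v 0 : ℤ) : ℝ)| := by exact_mod_cast Int.one_le_abs h0
      _ = |(Site.toComplex v).re| := by simp [Site.toComplex]
      _ ≤ ‖Site.toComplex v‖ := Complex.abs_re_le_norm _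
  · calc (1 : ℝ) ≤ |((v 1 : ℤ) : ℝ)| := by exact_mod_cast Int.one_le_abs h1
      _ = |(Site.toComplex v).im| := by simp [Site.toComplex]
      _ ≤ ‖Site.toComplex v‖ := Complex.abs_im_le_norm _

/-- **The crux contains Madras–Slade's open problem.** `TubeLowerBound` implies a pointwise
polynomial lower bound `Σ_{n ≤ N} c_n(v) x_c^n ≥ c |v|^{-C}` for the (partial sums of the)
critical two-point function `G_{x_c}(0, v)`, for every `v ≠ 0` — drop the tube constraint
(terms are nonnegative) and take `ℓ = |v|`.  Madras–Slade 1993, §8.1 p. 259: "we are not aware of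
any rigorous lower bound of the form `q_N ≥ const·N^{-p} μ^N`"; no pointwise polynomial floor
for `G_{x_c}` on `ℤ²` is in print.  [cite: MadrasSlade1993, §8.1 p. 259] -/
theorem twoPoint_floor (h : TubeLowerBound) :
    ∃ C c : ℝ, 0 < c ∧ ∀ v : Site 2, v ≠ 0 →
      ∃ N : ℕ, c * (dist (Site.toComplex (0 : Site 2)) (Site.toComplex v)) ^ (-C) ≤
        ∑ n ∈ Finset.range (N + 1), (Zd.countAt 2 n v : ℝ) * criticalFugacity ^ n := by
  classical
  obtain ⟨C, c, hc, h⟩ := h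
  refine ⟨C, c, hc, fun v hv => ?_⟩
  obtain ⟨N, hN⟩ := h 0 v _ (one_le_dist_of_ne_zero hv) le_rfl
  refine ⟨N, hN.trans (Finset.sum_le_sum fun n _ => ?_)⟩
  rw [sub_zero]
  calc ∑ _ω ∈ (Zd.sawFun 2 n v).filter (fun ω => ∀ i ≤ n,
          Metric.infDist (Site.toComplex (0 + ω i))
            (segment ℝ (Site.toComplex 0) (Site.toComplex v)) ≤
              dist (Site.toComplex (0 : Site 2)) (Site.toComplex v) / 10 + 2),
          criticalFugacity ^ n
        ≤ ∑ _ω ∈ Zd.sawFun 2 n v, criticalFugacity ^ n :=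
          Finset.sum_le_sum_of_subset_of_nonneg (Finset.filter_subset _ _)
            (fun _ _ _ => pow_nonneg criticalFugacity_pos.le _)
    _ = (Zd.countAt 2 n v : ℝ) * criticalFugacity ^ n := by
          rw [Finset.sum_const, nsmul_eq_mul, Zd.card_sawFun]


/-! ### A geometric-tail bound for tube masses -/

open Classical in
/-- If the confined counts of length `n ≥ L` weighted by `x^n` are `≤ θ^n` and no walk of length
`< L` reaches `v`, then every partial tube mass is `≤ θ^L / (1 - θ)`. [folklore] -/
theorem tubeMass_le_geom {x θ : ℝ} (hθ0 : 0 ≤ θ) (hθ1 : θ < 1) {u v : Site 2} {r : ℝ}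
    {L : ℕ}
    (hcard : ∀ n, L ≤ n → (((Zd.sawFun 2 n (v - u)).filter (fun ω => ∀ i ≤ n,
      Metric.infDist (Site.toComplex (u + ω i)) (segment ℝ (Site.toComplex u) (Site.toComplex v))
        ≤ r)).card : ℝ) * x ^ n ≤ θ ^ n)
    (hempty : ∀ n, n < L → Zd.sawFun 2 n (v - u) = ∅) (N : ℕ) :
    tubeMass x u v r N ≤ θ ^ L / (1 - θ) := by
  unfold tubeMass
  have step : ∀ n ∈ Finset.range (N + 1), (∑ _ω ∈ (Zd.sawFun 2 n (v - u)).filter (fun ω => ∀ i ≤ n,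
      Metric.infDist (Site.toComplex (u + ω i)) (segment ℝ (Site.toComplex u) (Site.toComplex v))
        ≤ r), x ^ n) ≤ if L ≤ n then θ ^ n else 0 := by
    intro n _
    rw [Finset.sum_const, nsmul_eq_mul]
    split_ifs with hLn
    · exact hcard n hLn
    · rw [hempty n (not_le.1 hLn), Finset.filter_empty, Finset.card_empty, Nat.cast_zero, zero_mul]
  refine (Finset.sum_le_sum step).trans ?_
  rw [← Finset.sum_filter]
  calc ∑ n ∈ (Finset.range (N + 1)).filter (fun n => L ≤ n), θ ^ n
      ≤ ∑ n ∈ Finset.Ico L (N + 1), θ ^ n := by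
        refine Finset.sum_le_sum_of_subset_of_nonneg ?_ (fun _ _ _ => pow_nonneg hθ0 _)
        intro n hn
        simp only [Finset.mem_filter, Finset.mem_range] at hn
        exact Finset.mem_Ico.2 ⟨hn.2, hn.1⟩
    _ ≤ θ ^ L / (1 - θ) := geom_sum_Ico_le_of_lt_one hθ0 hθ1

/-! ### (a, continued) The aspect-ratio coupling `|u - v| ≤ ℓ` is load-bearing (Kesten's pattern theorem) -/

/-- The diagonal lattice point `(L, L)`. [folklore] -/
def diag (L : ℕ) : Site 2 := ![(L : ℤ), (L : ℤ)]

/-- `Site.toComplex (diag L) = L + iL`. [folklore] -/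
theorem toComplex_diag (L : ℕ) : Site.toComplex (diag L) = ⟨L, L⟩ := by
  apply Complex.ext <;> simp [Site.toComplex, diag]

/-- **Tube ⇒ diagonal band.** A lattice point within `1/10 + 2` of the diagonal segment
`[0, (L,L)]` has `|x - y| ≤ 2`: `(x - y)² ≤ 2·dist² < 2·(2.12)² < 9`. [folklore] -/
theorem band_of_tube {L : ℕ} {p : Site 2}
    (h : Metric.infDist (Site.toComplex p)
      (segment ℝ (Site.toComplex (0 : Site 2)) (Site.toComplex (diag L))) ≤ 1 / 10 + 2) :
    |p 0 - p 1| ≤ 2 := by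
  have toComplex_zero : Site.toComplex (0 : Site 2) = 0 := by
    apply Complex.ext <;> simp [Site.toComplex]
  have hne : (segment ℝ (Site.toComplex (0 : Site 2)) (Site.toComplex (diag L))).Nonempty :=
    ⟨_, left_mem_segment ℝ _ _⟩
  obtain ⟨y, hy, hdy⟩ := (Metric.infDist_lt_iff hne).1
    (lt_of_le_of_lt h (by norm_num : (1 : ℝ) / 10 + 2 < 212 / 100))
  rw [toComplex_zero, toComplex_diag] at hy
  obtain ⟨a, b, -, -, -, rfl⟩ := hy
  have hd0 := dist_nonneg (x := Site.toComplex p) (y := a • (0 : ℂ) + b • (⟨L, L⟩ : ℂ))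
  have hsq : dist (Site.toComplex p) (a • (0 : ℂ) + b • (⟨L, L⟩ : ℂ)) ^ 2 < (212 / 100) ^ 2 := by
    nlinarith
  rw [Complex.dist_eq, Complex.sq_norm, Complex.normSq_apply] at hsq
  simp only [Complex.sub_re, Complex.sub_im, smul_zero, zero_add,
    Complex.smul_re, Complex.smul_im, smul_eq_mul, Site.toComplex_re, Site.toComplex_im] at hsq
  have h9 : (((p 0 : ℤ) : ℝ) - ((p 1 : ℤ) : ℝ)) ^ 2 < 9 := by
    nlinarith [sq_nonneg (((p 0 : ℤ) : ℝ) - b * L + (((p 1 : ℤ) : ℝ) - b * L))]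
  have h9' : ((p 0 - p 1 : ℤ) : ℝ) ^ 2 < 9 := by push_cast; exact h9
  have h9'' : (p 0 - p 1) ^ 2 < 9 := by exact_mod_cast h9'
  have h1 : p 0 - p 1 < 3 := by nlinarith [sq_nonneg (p 0 - p 1 + 3)]
  have h2 : -3 < p 0 - p 1 := by nlinarith [sq_nonneg (p 0 - p 1 - 3)]
  rw [abs_le]
  omega

/-- **No occurrence of Kesten's pattern `V` inside the band.** `V = N³ESENES³` (Madras–Slade
Fig. 7.4, in the tree's fixed orientation `Zd.OccV`) passes through `ω(k) + (0,3)` and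
`ω(k) + (3,0)`, whose values of `x - y` differ by `6`; a walk whose vertices all satisfy
`|x - y| ≤ 2` (five consecutive values) therefore has no occurrence of `(V, Q)`.
[cite: MadrasSlade1993, Definition 7.2.2 and Theorem 7.3.2 (Fig. 7.4)] -/
theorem not_occV_of_band {n : ℕ} {ω : ℕ → Site 2} (hband : ∀ i ≤ n, |ω i 0 - ω i 1| ≤ 2)
    (k : ℕ) : ¬ Zd.OccV n ω k := by
  rintro ⟨hk, hseg, -⟩
  have e3 : (Zd.vPt 3 : Site 2) = Zd.mk2 0 3 := by simp [Zd.vPt, Zd.vCoord]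
  have e11 : (Zd.vPt 11 : Site 2) = Zd.mk2 3 0 := by simp [Zd.vPt, Zd.vCoord]
  have a := hband (k + 3) (by omega)
  have b := hband (k + 11) (by omega)
  rw [hseg 3 (by norm_num), e3] at a
  rw [hseg 11 le_rfl, e11] at b
  simp only [Pi.add_apply, Zd.mk2_apply_zero, Zd.mk2_apply_one] at a b
  rw [abs_le] at a b
  omega

/-- The crux with the aspect-ratio coupling `dist u v ≤ ℓ` dropped (tube width no longer tied to
the distance between the endpoints). [folklore] -/
def WithoutDist : Prop :=
  ∃ C c : ℝ, 0 < c ∧ ∀ (u v : Site 2) (ℓ : ℝ), 1 ≤ ℓ →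
    ∃ N : ℕ, c * ℓ ^ (-C) ≤ tubeMass criticalFugacity u v (ℓ / 10 + 2) N

/-- **The coupling `|u - v| ≤ ℓ` is load-bearing.** Fix `ℓ = 1` (tube radius `21/10`) and let
`v = (L, L)` run along the diagonal: the tube sits inside the band `|x - y| ≤ 2` (`band_of_tube`),
confined walks have no occurrence of Kesten's pattern `V` (`not_occV_of_band`), so by the
in-tree pattern theorem `Zd.thm723` (Madras–Slade Thm 7.2.3 for `(V,Q)`) at most `((1-ε)μ)^n`
of them have length `n ≥ N₀`; with `x_c μ = 1` the critical tube mass is `≤ (1-ε)^L / ε → 0`,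
against the constant floor `c · 1^{-C} = c`.  Moral for provers: in a tube of FIXED width the
critical mass decays exponentially in the length (the strip is strictly subcritical at `x_c`);
only the widening `ℓ/10` can make the floor polynomial, i.e. the proof must see that a strip of
width `w` at `x_c` has correlation length `≳ w / log w` — an RSW-type input.
[cite: MadrasSlade1993, Theorem 7.2.3] -/
theorem not_withoutDist : ¬ WithoutDist := by
  classical
  rintro ⟨C, c, hc, h⟩
  obtain ⟨q, -, ε, hε0, hε1, N₀, hb⟩ := Zd.thm723 0
  have hb' : ∀ n, N₀ ≤ n →
      (((Zd.saws 2 n).filter fun ω => Zd.vCount n ω ≤ n / q).card : ℝ) ≤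
        ((1 - ε) * Zd.connectiveConstant 2) ^ n := hb
  -- choose the distance `L ≥ N₀` with `(1-ε)^L < c ε`
  obtain ⟨L, hL0, hL⟩ : ∃ L : ℕ, N₀ ≤ L ∧ (1 - ε) ^ L < c * ε := by
    have ht : Tendsto (fun n : ℕ => (1 - ε) ^ n) atTop (𝓝 0) :=
      tendsto_pow_atTop_nhds_zero_of_lt_one (by linarith) (by linarith)
    exact ((eventually_ge_atTop N₀).and (ht.eventually (gt_mem_nhds (mul_pos hc hε0)))).exists
  obtain ⟨N, hN⟩ := h 0 (diag L) 1 le_rfl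
  rw [Real.one_rpow, mul_one] at hN
  have hμ : 0 < Zd.connectiveConstant 2 := Zd.connectiveConstant_pos 2
  have hxμ : (1 - ε) * Zd.connectiveConstant 2 * criticalFugacity = 1 - ε := by
    rw [show criticalFugacity = (Zd.connectiveConstant 2)⁻¹ from rfl, mul_assoc,
      mul_inv_cancel₀ hμ.ne', mul_one]
  have hmass : tubeMass criticalFugacity 0 (diag L) (1 / 10 + 2) N ≤ (1 - ε) ^ L / (1 - (1 - ε)) := by
    refine tubeMass_le_geom (by linarith) (by linarith) (fun n hn => ?_) (fun n hn => ?_) N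
    · -- confined walks of length `n ≥ L ≥ N₀` are `V`-free, hence few
      have hsub : (Zd.sawFun 2 n (diag L - 0)).filter (fun ω => ∀ i ≤ n,
          Metric.infDist (Site.toComplex (0 + ω i))
            (segment ℝ (Site.toComplex 0) (Site.toComplex (diag L))) ≤ 1 / 10 + 2) ⊆
          (Zd.saws 2 n).filter fun ω => Zd.vCount n ω ≤ n / q := by
        intro ω hω
        rw [Finset.mem_filter] at hω ⊢
        obtain ⟨hω, htube⟩ := hω
        refine ⟨(Zd.mem_sawFun_iff_mem_saws.1 hω).1, ?_⟩
        have hband : ∀ i ≤ n, |ω i 0 - ω i 1| ≤ 2 := fun i hi => by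
          have := htube i hi
          rw [zero_add] at this
          exact band_of_tube this
        have h0 : Zd.vCount n ω = 0 := by
          unfold Zd.vCount Zd.vSites
          rw [Finset.card_eq_zero, Finset.filter_eq_empty_iff]
          exact fun k _ => not_occV_of_band hband k
        rw [h0]
        exact Nat.zero_le _
      have hcard := Finset.card_le_card hsub
      calc (((Zd.sawFun 2 n (diag L - 0)).filter (fun ω => ∀ i ≤ n,
            Metric.infDist (Site.toComplex (0 + ω i))
              (segment ℝ (Site.toComplex 0) (Site.toComplex (diag L))) ≤ 1 / 10 + 2)).card : ℝ) *
              criticalFugacity ^ n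
          ≤ ((1 - ε) * Zd.connectiveConstant 2) ^ n * criticalFugacity ^ n := by
            refine mul_le_mul_of_nonneg_right ?_ (pow_nonneg criticalFugacity_pos.le _)
            exact le_trans (by exact_mod_cast hcard) (hb' n (hL0.trans hn))
        _ = (1 - ε) ^ n := by rw [← mul_pow, hxμ]
    · -- no walk shorter than `L` reaches `(L, L)`
      refine Finset.eq_empty_of_forall_notMem fun ω hω => ?_
      have := le_of_mem_sawFun hω 0
      simp [diag] at this
      omega
  rw [show (1 : ℝ) - (1 - ε) = ε by ring] at hmass
  have : (1 - ε) ^ L / ε < c := by rwa [div_lt_iff₀ hε0]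
  linarith

/-! ### (a, continued) Criticality is load-bearing: the floor fails at every `x < x_c` -/

/-- The crux at a general fugacity `x` (`AtFugacity x_c` is the crux, `atFugacity_iff`). [folklore] -/
def AtFugacity (x : ℝ) : Prop :=
  ∃ C c : ℝ, 0 < c ∧ ∀ (u v : Site 2) (ℓ : ℝ), 1 ≤ ℓ →
    dist (Site.toComplex u) (Site.toComplex v) ≤ ℓ →
      ∃ N : ℕ, c * ℓ ^ (-C) ≤ tubeMass x u v (ℓ / 10 + 2) N

/-- `AtFugacity x_c` is the crux. [folklore] -/
theorem atFugacity_iff : AtFugacity criticalFugacity ↔ TubeLowerBound := Iff.rfl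

/-- The axis lattice point `(L, 0)`. [folklore] -/
def axisPt (L : ℕ) : Site 2 := ![(L : ℤ), 0]

/-- `Site.toComplex (axisPt L) = L`. [folklore] -/
theorem toComplex_axisPt (L : ℕ) : Site.toComplex (axisPt L) = (L : ℂ) := by
  apply Complex.ext <;> simp [Site.toComplex, axisPt]

/-- **Criticality is load-bearing**: for every fugacity `0 ≤ x < x_c` the floor fails, because the
whole (unconfined) two-point mass `Σ_{n ≥ L} c_n x^n` beyond distance `L` is `≤ θ^L/(1-θ)` with
`θ = x(1+η)μ < 1` (`c_n ≤ ((1+η)μ)^n` eventually, from `c_n^{1/n} → μ`), which is eventually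
below any polynomial `c L^{-C}`.  So any proof must use `x = x_c` exactly (for `x > x_c` the floor
only gets easier; the barrier `SupercriticalSAWSpaceFilling` concerns upper bounds and does not
bite). [cite: MadrasSlade1993, §1.2, (1.2.9)] -/
theorem not_atFugacity_of_lt {x : ℝ} (hx0 : 0 ≤ x) (hx : x < criticalFugacity) : ¬ AtFugacity x := by
  classical
  rintro ⟨C, c, hc, h⟩
  have toComplex_zero : Site.toComplex (0 : Site 2) = 0 := by
    apply Complex.ext <;> simp [Site.toComplex]
  have hμ : 0 < Zd.connectiveConstant 2 := Zd.connectiveConstant_pos 2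
  have hxc : criticalFugacity = (Zd.connectiveConstant 2)⁻¹ := rfl
  -- `θ = x (1+η) μ < 1` for `η` small
  have hxμ : x * Zd.connectiveConstant 2 < 1 := by
    rw [hxc] at hx
    calc x * Zd.connectiveConstant 2 < (Zd.connectiveConstant 2)⁻¹ * Zd.connectiveConstant 2 :=
          mul_lt_mul_of_pos_right hx hμ
      _ = 1 := inv_mul_cancel₀ hμ.ne'
  obtain ⟨η, hη, hθ1⟩ : ∃ η : ℝ, 0 < η ∧ x * ((1 + η) * Zd.connectiveConstant 2) < 1 := by
    rcases eq_or_lt_of_le hx0 with rfl | hxpos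
    · exact ⟨1, one_pos, by simp⟩
    · have hpos : 0 < x * Zd.connectiveConstant 2 := mul_pos hxpos hμ
      refine ⟨(1 - x * Zd.connectiveConstant 2) / (2 * (x * Zd.connectiveConstant 2)), by
        apply div_pos <;> linarith, ?_⟩
      have : x * ((1 + (1 - x * Zd.connectiveConstant 2) / (2 * (x * Zd.connectiveConstant 2))) *
          Zd.connectiveConstant 2) = (x * Zd.connectiveConstant 2 + 1) / 2 := by
        field_simp
        ring
      rw [this]
      linarith
  set θ := x * ((1 + η) * Zd.connectiveConstant 2) with hθ
  have hθ0 : 0 ≤ θ := mul_nonneg hx0 (by positivity)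
  -- `c_n x^n ≤ θ^n` for `n ≥ N₁`
  have hlt : Zd.connectiveConstant 2 < (1 + η) * Zd.connectiveConstant 2 := by nlinarith
  obtain ⟨N₁, hN₁⟩ := eventually_atTop.1 ((Zd.tendsto_count_rpow 2).eventually (gt_mem_nhds hlt))
  have hcount : ∀ n, N₁ ≤ n → 1 ≤ n → (Zd.count 2 n : ℝ) * x ^ n ≤ θ ^ n := by
    intro n hn hn1
    have hcn := hN₁ n hn
    have hc0 : 0 ≤ (Zd.count 2 n : ℝ) := by positivity
    have hn0 : (n : ℝ) ≠ 0 := by exact_mod_cast (show n ≠ 0 by omega)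
    have e : (Zd.count 2 n : ℝ) = ((Zd.count 2 n : ℝ) ^ (1 / (n : ℝ))) ^ n := by
      rw [← Real.rpow_natCast, ← Real.rpow_mul hc0, one_div_mul_cancel hn0, Real.rpow_one]
    rw [e, hθ, mul_comm x, mul_pow]
    exact mul_le_mul_of_nonneg_right (pow_le_pow_left₀ (by positivity) hcn.le n) (pow_nonneg hx0 _)
  -- a natural exponent `K ≥ C`, and `L` large: `L ≥ N₁`, `L ≥ 1`, `L^K θ^L < c (1 - θ)`
  obtain ⟨K, hK⟩ : ∃ K : ℕ, C ≤ K := exists_nat_ge C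
  have hlim : Tendsto (fun n : ℕ => (n : ℝ) ^ K * θ ^ n) atTop (𝓝 0) :=
    tendsto_pow_const_mul_const_pow_of_abs_lt_one K (by rw [abs_of_nonneg hθ0]; exact hθ1)
  obtain ⟨L, hL1, hLN, hL⟩ : ∃ L : ℕ, 1 ≤ L ∧ N₁ ≤ L ∧ (L : ℝ) ^ K * θ ^ L < c * (1 - θ) := by
    obtain ⟨L, ⟨h1, h2⟩, h3⟩ := (((eventually_ge_atTop 1).and (eventually_ge_atTop N₁)).and
      (hlim.eventually (gt_mem_nhds (mul_pos hc (sub_pos.2 hθ1))))).exists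
    exact ⟨L, h1, h2, h3⟩
  have hLpos : (0 : ℝ) < L := by exact_mod_cast hL1
  -- the floor at `u = 0`, `v = (L, 0)`, `ℓ = L`
  obtain ⟨N, hN⟩ := h 0 (axisPt L) L (by exact_mod_cast hL1)
    (by rw [toComplex_zero, toComplex_axisPt]; simp)
  -- upper bound on the mass: drop the tube, keep only `n ≥ L`
  have hmass : tubeMass x 0 (axisPt L) ((L : ℝ) / 10 + 2) N ≤ θ ^ L / (1 - θ) := by
    refine tubeMass_le_geom hθ0 hθ1 (fun n hn => ?_) (fun n hn => ?_) N
    · calc (((Zd.sawFun 2 n (axisPt L - 0)).filter (fun ω => ∀ i ≤ n,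
            Metric.infDist (Site.toComplex (0 + ω i))
              (segment ℝ (Site.toComplex 0) (Site.toComplex (axisPt L))) ≤ (L : ℝ) / 10 + 2)).card : ℝ) *
              x ^ n
          ≤ (Zd.count 2 n : ℝ) * x ^ n := by
            refine mul_le_mul_of_nonneg_right ?_ (pow_nonneg hx0 _)
            have h1 := Finset.card_le_card (Finset.filter_subset (fun ω => ∀ i ≤ n,
              Metric.infDist (Site.toComplex (0 + ω i))
                (segment ℝ (Site.toComplex 0) (Site.toComplex (axisPt L))) ≤ (L : ℝ) / 10 + 2)
              (Zd.sawFun 2 n (axisPt L - 0)))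
            have h2 : (Zd.sawFun 2 n (axisPt L - 0)).card ≤ Zd.count 2 n := by
              rw [← Zd.card_saws]
              exact Finset.card_le_card fun ω hω => (Zd.mem_sawFun_iff_mem_saws.1 hω).1
            exact_mod_cast h1.trans h2
        _ ≤ θ ^ n := hcount n (hLN.trans hn) (hL1.trans hn)
    · refine Finset.eq_empty_of_forall_notMem fun ω hω => ?_
      have := le_of_mem_sawFun hω 0
      simp [axisPt] at this
      omega
  -- lower bound: `c L^{-C} ≥ c L^{-K} = c / L^K`
  have hfloor : c / (L : ℝ) ^ K ≤ c * (L : ℝ) ^ (-C) := by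
    rw [div_eq_mul_inv, ← Real.rpow_natCast, ← Real.rpow_neg hLpos.le]
    refine mul_le_mul_of_nonneg_left ?_ hc.le
    exact Real.rpow_le_rpow_of_exponent_le (by exact_mod_cast hL1) (by linarith)
  have hLK : (0 : ℝ) < (L : ℝ) ^ K := pow_pos hLpos K
  have key : θ ^ L / (1 - θ) < c / (L : ℝ) ^ K := by
    rw [div_lt_div_iff₀ (by linarith) hLK]
    nlinarith
  linarith

/-- Packaging: the floor holds at no subcritical fugacity. [folklore] -/
theorem atFugacity_subcritical_false : ∀ x ∈ Set.Ico (0 : ℝ) criticalFugacity, ¬ AtFugacity x :=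
  fun _ hx => not_atFugacity_of_lt hx.1 hx.2

/-! ## Cycle 2 (refuter-cdisprove g2, 2026-08-16) — the registered line `subcritical-renewal-floor`

Targets of this cycle = the five stubs of the registered skeleton
`Cruxes/TubeLowerBound/Lines/subcritical-renewal-floor.lean` (sha `aa7e283b6144`):
`stub_kestenTilt : KestenTiltExists` (S1), `stub_spanHyperscaling : SpanHyperscaling` (S2, hardest),
`stub_transversalHyperscaling : TransversalHyperscaling` (S3), `stub_renewalEngine : S1 → S2 → S3 →
ConeBridgeFloor` (S4), `stub_staircaseAssembly : ConeBridgeFloor → TightTubeFloor` (S5).  The Lines file is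
not an importable module, so the statements attacked below are VERBATIM COPIES of its `def`s.

Verdicts (details in the docstrings below):
* S5's target `TightTubeFloor` is EQUIVALENT to the crux (`tightTubeFloor_iff`): S5 is exactly
  "`ConeBridgeFloor` ⇒ crux"; no separating model is possible without settling the crux.
* `ConeBridgeFloor`: any witness has `κ ≤ 1/4` (`coneBridgeFloor_kappa_le`: the end cone at `i = 0` reads
  `4|t| ≤ s`); provers must not hope for a large aperture.  With `κ ≤ 1/4` the cone ∩ tube always contains a
  monotone lattice staircase (the interval `[t − (s−x)/4, tx/s + κs/4 + 1]` has length `≥ 1` for every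
  column `x`), so the statement is non-vacuous at small scales; it is a critical polynomial floor like the
  crux and is not finitely refutable.
* S1 is print (MS 1993 (4.2.15) p. 93: `Σ_L A_z(L) e^{m(z)L} = 1` for `0 < z < z_c`, from `a_L ≥ χ(z)⁻²`;
  continuity of `m` = Lemma 4.2.7(a)-type concavity in `log z`; `m(z) ↓ 0` as `z ↑ z_c` by upper
  semicontinuity and `B(z_c) = ∞`).  Checked against the tree's `IsBreak`/`IsIrrBridge` (same break-point
  convention as MS (4.2.1), so bridges = free monoid on `irrWords`, `eq_of_append_eq`).  No attack.
* S2/S3 are open single-scale hyperscaling statements for Kesten's tilted law; they are asymptotic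
  (`∃ m₀`) with free constants, hence not finitely refutable; the cheapest falsifier named by the planner
  (exact irreducible-bridge statistics by span, tilted below `x_c`) was RUN — see NUMERICS: no sign of
  failure (`m·E[X²]/E[X]` stays `≤ 0.6` and DEcreases towards `x_c`; `T·m/E[X] ≈ 0.5` flat), Kesten's
  identity (4.2.15) reproduced to `4·10⁻⁴`.
* S4 is an implication between open statements; its conclusion is constrained only by `κ ≤ 1/4`.

NUMERICS (this seat, cycle 2; exact ROW transfer matrix for bridges of span `L` on `ℤ²` resolved by the
transversal displacement `y`, at fixed fugacity; pure-python `tm/strip_tm.py`, validated against brute-force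
enumeration for `L ≤ 5`; kit jobs j014080–j014083 (`L ≤ 12` at `z/z_c = 1, .97, .95, .9`, results attach to the item as
compute evidence); the numbers below are the local `L ≤ 9` run, to be refreshed from the jobs at the next re-arm).  `B_z(L) = Σ_{bridges of span L} z^{|ω|}`
(MS Def. 4.1.7), `A_z(L)` = irreducible ones by the renewal deconvolution (4.2.9), `A_z(L,y)` by (4.2.10).
* `z = z_c = 1/μ`, `μ = 2.63815853`: `B(L) = .842 .760 .707 .669 .639 .615 .595 .578 .563` (`L = 1..9`),
  local log-slope `−0.16 → −0.22` drifting towards the predicted `−1/4` (`B_{z_c}(L) ≍ L^{−1/4}`, DGKLP);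
  `A(L) = .842 .0514 .0241 .0142 .00946 .00683 .00520 .00412 .00335`, local slope `−1.83 → −1.75`
  (prediction `−7/4`: critical irreducible-bridge span law of tail index `3/4`, infinite mean — MS p. 92's
  "believed `b_N/μ^N → 0`" in span form); Kesten-by-span `Σ_{L ≤ 9} A_{z_c}(L) = 0.9605`, power tail adds
  `0.040` → `1.0006` (should be `1`: (4.2.4)).  Transversally, irreducible bridges are TALL:
  `E[Y² | span L] ≈ 5.8 L²` (bridges: `≈ 0.85 L²`), kurtosis `E[Y⁴]/E[Y²]² ≈ 1.98` stable in `L`.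
* `z < z_c` (Kesten tilt `p_L = A_z(L) e^{m(z)L}`, `m(z)` from `B`-ratios; `a_L = B e^{mL}` converges to
  `C_z = .963/.912/.852` at `z/z_c = .8/.9/.95`, cf. Thm 4.2.5): `m(z) = .537/.304/.177` (`ξ = 1.9/3.3/5.6`);
  `Σ_{L ≤ 9} p_L = 1 − 5·10⁻⁷ / 1 − 4·10⁻⁵ / 1 − 4·10⁻⁴` ((4.2.15) ✓); the law is dominated by its ATOM
  `p_1 = A_z(1)e^{m} = z(1+z)/(1−z)·e^{m(z)} = .971/.941/.914` (ALL span-1 bridges — a first step followed by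
  a vertical run — are irreducible), so `E[X] = 1.04/1.10/1.17` stays `O(1)` down to `ξ ≈ 6` and grows only
  like `ξ^{1/4}`; S2's ratio `m·E[X²]/E[X] = .590/.393/.281`; S3's lower ratio
  `T·m/E[X] = .461/.510/.517` with `T = E[min(Y², ξ²)]`, and `E[Y²]·m/E[X] = .95/.98/.92`; mass separation
  `θ = (m_A − m)/m ≈ 1.8/1.6/1.4` after removing the `L^{−7/4}` prefactor bias (MS Cor. 4.4.4: `θ ≤ 2`) —
  slowly decreasing, lever arm too short to distinguish `θ → θ* > 0` (S2) from `θ → 0`.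
-/

/-! ### S5's target is the crux -/

/-- Verbatim copy of `SubcriticalRenewalFloor.TightTubeFloor` (skeleton aa7e283b6144): the crux at its own
scale `ℓ₀ = max(1, |u − v|)`, with `0 ≤ C` built in. [folklore] -/
def TightTubeFloor : Prop :=
  ∃ C c : ℝ, 0 ≤ C ∧ 0 < c ∧ ∀ (u v : Site 2), ∃ N : ℕ,
    c * (max 1 (dist (Site.toComplex u) (Site.toComplex v))) ^ (-C) ≤
      ∑ n ∈ Finset.range (N + 1), ∑ _ω ∈ (Zd.sawFun 2 n (v - u)).filter (fun ω => ∀ i ≤ n,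
          Metric.infDist (Site.toComplex (u + ω i)) (segment ℝ (Site.toComplex u) (Site.toComplex v)) ≤
            max 1 (dist (Site.toComplex u) (Site.toComplex v)) / 10 + 2),
        criticalFugacity ^ n

/-- **`TightTubeFloor ↔ TubeLowerBound`.** The skeleton proves `→` inside `TubeLowerBound_of`
(monotonicity: the tube only widens and `c ℓ^{−C}` only shrinks in `ℓ` once `0 ≤ C`); `←` is the instance
`ℓ = ℓ₀` together with `constraints` (`0 ≤ C` is automatic for any witness of the crux).  So stub S5
(`ConeBridgeFloor → TightTubeFloor`) is literally "`ConeBridgeFloor` implies the crux": it cannot be refuted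
without refuting the crux under `ConeBridgeFloor`, and cannot be by-passed. [folklore] -/
theorem tightTubeFloor_iff : TightTubeFloor ↔ TubeLowerBound := by
  classical
  rw [tubeLowerBound_iff]
  constructor
  · rintro ⟨C, c, hC, hc, h⟩
    refine ⟨C, c, hc, fun u v ℓ hℓ hd => ?_⟩
    obtain ⟨N, hN⟩ := h u v
    set ℓ₀ : ℝ := max 1 (dist (Site.toComplex u) (Site.toComplex v)) with hℓ₀
    have hℓ₀ℓ : ℓ₀ ≤ ℓ := max_le hℓ hd
    have hℓ₀pos : 0 < ℓ₀ := lt_of_lt_of_le one_pos (le_max_left _ _)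
    refine ⟨N, le_trans ?_ (hN.trans ?_)⟩
    · refine mul_le_mul_of_nonneg_left ?_ hc.le
      exact Real.rpow_le_rpow_of_nonpos hℓ₀pos hℓ₀ℓ (by linarith)
    · unfold tubeMass
      refine Finset.sum_le_sum fun n _ => ?_
      refine Finset.sum_le_sum_of_subset_of_nonneg ?_ fun _ _ _ => pow_nonneg criticalFugacity_pos.le n
      intro ω hω
      rw [Finset.mem_filter] at hω ⊢
      refine ⟨hω.1, fun i hi => (hω.2 i hi).trans ?_⟩
      linarith
  · rintro ⟨C, c, hc, h⟩
    have hC : 0 ≤ C := (constraints hc h).1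
    refine ⟨C, c, hC, hc, fun u v => ?_⟩
    exact h u v _ (le_max_left _ _) (le_max_right _ _)

/-! ### The transfer statement `ConeBridgeFloor` of the line: aperture constraint -/

/-- Verbatim copy of `SubcriticalRenewalFloor.ConeBridgeFloor` (skeleton aa7e283b6144): a polynomial floor
for the `x_c`-mass of bridges `0 → (s, t)`, `|t| ≤ κ s`, confined to the `κ s/4 + 1`-tube of their chord and
to the end cone `4|y − t| ≤ s − x`. [folklore] -/
def ConeBridgeFloor : Prop :=
  ∃ κ C c : ℝ, 0 < κ ∧ 0 < c ∧ ∀ (s : ℕ) (t : ℤ), 1 ≤ s → |(t : ℝ)| ≤ κ * s →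
    ∃ N : ℕ, c * (s : ℝ) ^ (-C) ≤ ∑ n ∈ Finset.range (N + 1),
      ∑ _ω ∈ (Zd.bridges 2 n).filter (fun ω => ω n = ![(s : ℤ), t] ∧
          ∀ i ≤ n, |((ω i 1 : ℤ) : ℝ) - (t : ℝ) / (s : ℝ) * ((ω i 0 : ℤ) : ℝ)| ≤ κ * s / 4 + 1 ∧
            4 * |ω i 1 - t| ≤ (s : ℤ) - ω i 0),
        criticalFugacity ^ n

open Classical in
/-- The cone-and-tube bridge mass of `ConeBridgeFloor` (its double sum, as a function). [folklore] -/
def coneMass (κ : ℝ) (s : ℕ) (t : ℤ) (N : ℕ) : ℝ :=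
  ∑ n ∈ Finset.range (N + 1),
    ∑ _ω ∈ (Zd.bridges 2 n).filter (fun ω => ω n = ![(s : ℤ), t] ∧
        ∀ i ≤ n, |((ω i 1 : ℤ) : ℝ) - (t : ℝ) / (s : ℝ) * ((ω i 0 : ℤ) : ℝ)| ≤ κ * s / 4 + 1 ∧
          4 * |ω i 1 - t| ≤ (s : ℤ) - ω i 0),
      criticalFugacity ^ n

/-- **The end cone pins the start**: the cone condition at `i = 0` (`ω 0 = 0`) reads `4|t| ≤ s`, so the
cone mass vanishes identically whenever `s < 4|t|`. [folklore] -/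
theorem coneMass_eq_zero (κ : ℝ) {s : ℕ} {t : ℤ} (hst : (s : ℤ) < 4 * |t|) (N : ℕ) :
    coneMass κ s t N = 0 := by
  classical
  unfold coneMass
  refine Finset.sum_eq_zero fun n _ => Finset.sum_eq_zero fun ω hω => ?_
  exfalso
  rw [Finset.mem_filter] at hω
  obtain ⟨hω, -, hcone⟩ := hω
  have h0 : ω 0 = 0 := (Zd.mem_saws.1 (Zd.mem_bridges.1 hω).1).1
  have h1 := (hcone 0 (Nat.zero_le n)).2
  rw [h0] at h1
  have e1 : (0 : Site 2) 1 = 0 := rfl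
  have e0 : (0 : Site 2) 0 = 0 := rfl
  rw [e1, e0, zero_sub, abs_neg, sub_zero] at h1
  exact absurd (lt_of_le_of_lt h1 hst) (lt_irrefl _)

/-- **Aperture constraint.** Any witness `(κ, C, c)` of `ConeBridgeFloor` has `κ ≤ 1/4`: for `κ > 1/4`
take `s` with `(κ − 1/4)s ≥ 2` and `t = ⌊κ s⌋`; then `|t| ≤ κ s` is admissible but `4t > s`, the cone mass
is `0` (`coneMass_eq_zero`) and the floor `c s^{−C} > 0` fails.  (With `κ ≤ 1/4` the cone ∩ tube contains a
monotone staircase for every admissible `(s,t)`, so no further cheap constraint exists.)  Consequence for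
S5: the staircase must work with an aperture `κ` that the HYPOTHESIS supplies (possibly tiny), which the
line card's case split `b ≤ κ a` / `b > κ a` (thresholds `a ≥ 40/κ`) does. [folklore] -/
theorem coneBridgeFloor_kappa_le {κ C c : ℝ} (hc : 0 < c)
    (h : ∀ (s : ℕ) (t : ℤ), 1 ≤ s → |(t : ℝ)| ≤ κ * s → ∃ N : ℕ, c * (s : ℝ) ^ (-C) ≤ coneMass κ s t N) :
    κ ≤ 1 / 4 := by
  by_contra hκ
  push Not at hκ
  have hκ' : 0 < κ - 1 / 4 := by linarith
  obtain ⟨s, hs⟩ : ∃ s : ℕ, 2 / (κ - 1 / 4) ≤ s := exists_nat_ge _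
  have hs2 : 2 ≤ (s : ℝ) * (κ - 1 / 4) := (div_le_iff₀ hκ').1 hs
  have hs1 : 1 ≤ s := by
    rcases Nat.eq_zero_or_pos s with rfl | hpos
    · norm_num at hs2
    · exact hpos
  set t : ℤ := ⌊κ * s⌋ with ht
  have hκs : 0 ≤ κ * s := by
    have : (0 : ℝ) ≤ s := Nat.cast_nonneg s
    nlinarith
  have ht0 : (0 : ℤ) ≤ t := Int.floor_nonneg.2 hκs
  have ht0' : (0 : ℝ) ≤ (t : ℝ) := by exact_mod_cast ht0
  have htle : (t : ℝ) ≤ κ * s := Int.floor_le _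
  have htgt : κ * s < (t : ℝ) + 1 := Int.lt_floor_add_one _
  obtain ⟨N, hN⟩ := h s t hs1 (by rw [abs_of_nonneg ht0']; exact htle)
  have hst : (s : ℤ) < 4 * |t| := by
    rw [abs_of_nonneg ht0]
    have : (s : ℝ) < 4 * (t : ℝ) := by nlinarith
    exact_mod_cast this
  rw [coneMass_eq_zero κ hst] at hN
  have : 0 < c * (s : ℝ) ^ (-C) :=
    mul_pos hc (Real.rpow_pos_of_pos (by exact_mod_cast hs1) _)
  linarith

/-- Packaging: `ConeBridgeFloor` forces `κ ≤ 1/4` on its witness (restated on the verbatim def).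
[folklore] -/
theorem coneBridgeFloor_witness_kappa_le (h : ConeBridgeFloor) :
    ∃ κ C c : ℝ, 0 < κ ∧ κ ≤ 1 / 4 ∧ 0 < c ∧ ∀ (s : ℕ) (t : ℤ), 1 ≤ s → |(t : ℝ)| ≤ κ * s →
      ∃ N : ℕ, c * (s : ℝ) ^ (-C) ≤ coneMass κ s t N := by
  obtain ⟨κ, C, c, hκ, hc, h⟩ := h
  exact ⟨κ, C, c, hκ, coneBridgeFloor_kappa_le hc h, hc, h⟩

end Summit.CriticalPhenomena.SAWScalingLimit.Cruxes.TubeLowerBound.Disproof
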